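import Mathlib
import Summits.ResolutionOfSingularities.ResolutionOfSingularities.Theorems.WeightedInvariantLocalWeightedDropWildMonicFlagComplete
import Summits.ResolutionOfSingularities.ResolutionOfSingularities.Theorems.WeightedInvariantLocalWeightedDropWildMonicFlagShearOrder
import Summits.ResolutionOfSingularities.ResolutionOfSingularities.Theorems.WeightedInvariantLocalWeightedDropWildMonicFlagTripleBasic

/-!
# `WeightedInvariant.LocalWeightedDrop`, line `hasse-ridge-face-selection`, S3ρ sub-stub S3ρD `stub_wildMonicSurfaceDescent`: item D-0
# «maximising flag» — COMPLETENESS OF A SETTING CLASS OF FLAGS `(g, h)` (re-centring AND plane shear: the limit pair stays in the class)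

Crux item stmt-ResolutionOfSingularities-8899 `LocalWeightedDrop` (route `ResolutionOfSingularities/WeightedInvariant`), engine of the door
`HypersurfaceCentreConstruction` stmt-ResolutionOfSingularities-19897.  [OURS · L1 W4.3, chain w43, res-L1-w43-stub-3 (gen 3) on roadmap item
D-0 of `L/res-L1-w43-stub-7/S3RHOD-ROADMAP.md` (owners res-type-083 / stub-7); spec `L/res-L1-w43-stub-3/D0-SPEC.md` §8 (D-0d case (β)).
MODEL: Perlega, arXiv:2011.14443 Ch. 5 §3, proof of Prop. 5.3.5 (p0066 L60 – p0067 L40): the limit pair `(g_∞, h_∞)` of a chain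
`(g_i, h_i)` of setting-preserving simultaneous changes `z ↦ z + g`, `y ↦ y + h`, with the RE-EXPANSION of `G̃_k = Σ_{i ≥ k} G_i` in the
moving coordinate `y_k` («`G̃_{k,l} = Σ binom(j,l) G_{i,j} H_{k,i}^{j−l}`», p0067 L10–L30).  Here the re-expansion is the TRANSPORT
`g̃_k = θ^*_{h_∞ − h_k} g_k` by the composition law `flagTuple_flagTuple` (`…FlagTripleBasic`), the lines survive the transport by
`weightedOrder_subst_shift` (`…FlagShearOrder`: a shear with `M' ≤ δ₀!·ord φ` preserves `ord_{![δ₀!, M']}`), the `h`-limit and the `g`-limit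
are the coefficientwise limits of `…FlagCauchy`, and membership of the limit is `wMin_le_wMin_shift` + maximality as in `…FlagComplete`.
The class is cut out by a family `W` of SHEAR-INVARIANT weights (`hW`; in D-0: `(1,1)` and `(1,0)`, the letter `x₁` not being a boundary
letter).  Definition-free.]

* `natCast_le_mul_order_iff` — `M ≤ c·ord f ⟺ f has no monomial xⁿ with c·n < M` (one variable); `exists_powerSeries_limit_of_mul_order`
  — the limit shear for scaled closeness;
* `constantCoeff_pureShift`, `constantCoeff_subst_pureShift` — shears keep constant terms zero;
* **`exists_limit_mem_pairClass`** — COMPLETENESS: a chain `(g_j, h_j)` in the class with `N j ≤ δ₀!·ord(h_{j+1} − h_j)` and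
  `g_{j'} − θ^*_{h_{j'} − h_j} g_j` on or above every `M'`-line (`M' ≤ N j`, `j < j'`) has a limit `(g_∞, h_∞)` IN THE CLASS with the same
  closeness to every member.
-/

set_option linter.dupNamespace false -- mandated namespace of this single-conjunct summit

namespace Summit.ResolutionOfSingularities.ResolutionOfSingularities.Theorems

namespace WildMonic

open MvPowerSeries
open Literature.AlgebraicGeometry.Resolution

variable {k : Type} [Field k] {d : ℕ}

/-! ### Small tools -/

/-- `M ≤ c·ord f` iff `f` has no monomial `xⁿ` with `c·n < M` (`c > 0`). -/
theorem natCast_le_mul_order_iff {c : ℕ} (hc : 0 < c) (f : PowerSeries k) (M : ℕ) :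
    (M : ℕ∞) ≤ (c : ℕ∞) * f.order ↔ ∀ n : ℕ, c * n < M → PowerSeries.coeff n f = 0 := by
  constructor
  · intro h n hn
    by_contra hne
    have h1 : f.order ≤ n := PowerSeries.order_le n hne
    have h2 : (c : ℕ∞) * f.order ≤ ((c * n : ℕ) : ℕ∞) := by push_cast; gcongr
    exact absurd (lt_of_le_of_lt (h.trans h2) (by exact_mod_cast hn)) (lt_irrefl _)
  · intro h
    by_cases hf : f = 0
    · rw [hf, PowerSeries.order_zero, ENat.mul_top (by exact_mod_cast hc.ne')]; exact le_top
    · have hfin : f.order ≠ ⊤ := by rwa [ne_eq, PowerSeries.order_eq_top]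
      obtain ⟨n, hn⟩ := ENat.ne_top_iff_exists.mp hfin
      rw [← hn]
      by_contra hlt
      rw [not_le] at hlt
      have h1 : c * n < M := by
        have : (c : ℕ∞) * (n : ℕ∞) = ((c * n : ℕ) : ℕ∞) := by push_cast; rfl
        rw [this] at hlt; exact_mod_cast hlt
      have h2 := h n h1
      have h3 : PowerSeries.coeff n f ≠ 0 := by
        have := PowerSeries.coeff_order hf
        rwa [← hn, ENat.toNat_coe] at this
      exact h3 h2

/-- The letters of a shear have no constant term. -/
theorem constantCoeff_pureShift (φ : PowerSeries k) (hφ : PowerSeries.constantCoeff φ = 0) (i : Fin 2) :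
    constantCoeff (PurePowerFlag.shift φ i) = 0 := by
  unfold PurePowerFlag.shift
  by_cases hi : i = 1
  · rw [if_pos hi, map_add, constantCoeff_X, zero_add]
    exact PowerSeries.constantCoeff_subst_eq_zero (constantCoeff_X 0) φ hφ
  · rw [if_neg hi, constantCoeff_X]

/-- A shear keeps constant terms zero. -/
theorem constantCoeff_subst_pureShift {φ : PowerSeries k} (hφ : PowerSeries.constantCoeff φ = 0) {g : MvPowerSeries (Fin 2) k}
    (hg : constantCoeff g = 0) : constantCoeff (subst (PurePowerFlag.shift φ) g) = 0 :=
  constantCoeff_subst_eq_zero (HauserPerlega2024.hasSubst_shift (0 : Fin 2) 1 φ hφ) (constantCoeff_pureShift φ hφ) hg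

/-- The limit shear for scaled closeness: a chain `h_j` of shears with `N j ≤ c·ord(h_{j+1} − h_j)`, `N` strictly increasing, has a
limit shear `h_∞` with `N j ≤ c·ord(h_∞ − h_j)` for every `j` (`…FlagCauchy` with the negligible monomials `xⁿ`, `c·n < M`).
[cite: Perlega2020, Prop. 5.3.5 proof (arXiv:2011.14443 Ch. 5 §3, p0067 L1–L10); HauserPerlega2024, Prop. 3 proof p. 792 (`y_∞`)] -/
theorem exists_powerSeries_limit_of_mul_order {c : ℕ} (hc : 0 < c) (h : ℕ → PowerSeries k) (N : ℕ → ℕ) (hN : StrictMono N)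
    (h0 : ∀ j, PowerSeries.constantCoeff (h j) = 0) (hclose : ∀ j, (N j : ℕ∞) ≤ (c : ℕ∞) * (h (j + 1) - h j).order) :
    ∃ hinf : PowerSeries k, PowerSeries.constantCoeff hinf = 0 ∧ ∀ j, (N j : ℕ∞) ≤ (c : ℕ∞) * (hinf - h j).order := by
  have hstepH : ∀ j (e : Unit →₀ ℕ), c * e () < N j → MvPowerSeries.coeff e ((h (j + 1) : MvPowerSeries Unit k) - h j) = 0 := by
    intro j e he
    have h1 := (natCast_le_mul_order_iff hc _ _).1 (hclose j) _ he
    rwa [PowerSeries.coeff_def (s := e) rfl] at h1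
  have h1H : ∃ j, c * (0 : Unit →₀ ℕ) () < N j :=
    ⟨1, by rw [Finsupp.zero_apply, mul_zero]; exact lt_of_le_of_lt (Nat.zero_le _) (hN Nat.zero_lt_one)⟩
  obtain ⟨hinf, hhinf0, -, hhinf⟩ := exists_forall_coeff_sub_eq_zero_of_chain'₀ (σ := Unit) (R := k)
    (fun M e => c * e () < M) (fun hMM' hlt => lt_of_lt_of_le hlt hMM') (fun j => (h j : MvPowerSeries Unit k)) N hN.monotone
    (fun M => ⟨M, hN.le_apply⟩) hstepH (fun j => by change PowerSeries.constantCoeff (h j) = 0; exact h0 j) h1H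
  refine ⟨hinf, hhinf0, fun j => (natCast_le_mul_order_iff hc _ _).2 fun n hn => ?_⟩
  rw [PowerSeries.coeff_def (s := Finsupp.single () n) Finsupp.single_eq_same]
  exact hhinf j _ (by rwa [Finsupp.single_eq_same])

/-! ### Completeness of the class of pairs -/

/-- **THE LIMIT PAIR STAYS IN THE CLASS** (Per17 Prop. 5.3.5 proof: «`(g_∞, h_∞) ∈ 𝒢`», with the re-expansion of `G̃_k`).  Data: base
tuple `A` (`0 < d`); a family `W` of SHEAR-INVARIANT weights (`hW`) with class values `m w` — the class is
`{(g, h) : g(0) = h(0) = 0, ∀ w ∈ W, wMin w (flagTuple d A g h) = m w}` —, some `m w` positive, no pair dominating the class values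
(`hmax`); level lines with weights `![δ₀!, M']`, thresholds `M'·δ₀ + w_{M'}(r₀)`.  A chain `(g_j, h_j)` in the class with strictly
increasing levels `N`, `N j ≤ δ₀!·ord(h_{j+1} − h_j)` and, for `j < j'`, `g_{j'} − θ^*_{h_{j'} − h_j} g_j` on or above every `M'`-line,
`M' ≤ N j`, has a LIMIT `(g_∞, h_∞)` IN THE CLASS, with `N j ≤ δ₀!·ord(h_∞ − h_j)` and `g_∞ − θ^*_{h_∞ − h_j} g_j` on or above every `M'`-line,
`M' ≤ N j`, for every `j`. [cite: Perlega2020, Prop. 5.3.5 proof (arXiv:2011.14443 Ch. 5 §3, p0066 L60 – p0067 L40)] -/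
theorem exists_limit_mem_pairClass (hd : 0 < d) (A : Fin d → MvPowerSeries (Fin 2) k) (W : Set (Fin 2 → ℕ))
    (m : (Fin 2 → ℕ) → ℕ∞) (δ₀ : ℕ) (r₀ : Fin 2 →₀ ℕ)
    (hW : ∀ w ∈ W, ∀ φ : PowerSeries k, PowerSeries.constantCoeff φ = 0 →
      (∀ B : Fin d → MvPowerSeries (Fin 2) k, wMin w (fun i => subst (PurePowerFlag.shift φ) (B i)) = wMin w B) ∧
      ∀ g : MvPowerSeries (Fin 2) k, (subst (PurePowerFlag.shift φ) g).weightedOrder w = g.weightedOrder w)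
    (hpos : ∃ w ∈ W, 0 < m w)
    (hmax : ∀ (g : MvPowerSeries (Fin 2) k) (h : PowerSeries k), constantCoeff g = 0 → PowerSeries.constantCoeff h = 0 →
      (∀ w ∈ W, m w ≤ wMin w (flagTuple d A g h)) → ∀ w ∈ W, wMin w (flagTuple d A g h) ≤ m w)
    (g : ℕ → MvPowerSeries (Fin 2) k) (h : ℕ → PowerSeries k) (N : ℕ → ℕ) (hN : StrictMono N)
    (hc : ∀ j, constantCoeff (g j) = 0 ∧ PowerSeries.constantCoeff (h j) = 0 ∧ ∀ w ∈ W, wMin w (flagTuple d A (g j) (h j)) = m w)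
    (hcloseh : ∀ j, (N j : ℕ∞) ≤ (δ₀.factorial : ℕ∞) * (h (j + 1) - h j).order)
    (hlines : ∀ j j', j < j' → ∀ M', M' ≤ N j → ((M' * δ₀ + Finsupp.weight ![δ₀.factorial, M'] r₀ : ℕ) : ℕ∞) ≤
      (d.factorial : ℕ∞) * (g j' - subst (PurePowerFlag.shift (h j' - h j)) (g j)).weightedOrder ![δ₀.factorial, M']) :
    ∃ (ginf : MvPowerSeries (Fin 2) k) (hinf : PowerSeries k), constantCoeff ginf = 0 ∧ PowerSeries.constantCoeff hinf = 0 ∧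
      (∀ w ∈ W, wMin w (flagTuple d A ginf hinf) = m w) ∧
      ∀ j, (N j : ℕ∞) ≤ (δ₀.factorial : ℕ∞) * (hinf - h j).order ∧
        ∀ M', M' ≤ N j → ((M' * δ₀ + Finsupp.weight ![δ₀.factorial, M'] r₀ : ℕ) : ℕ∞) ≤
          (d.factorial : ℕ∞) * (ginf - subst (PurePowerFlag.shift (hinf - h j)) (g j)).weightedOrder ![δ₀.factorial, M'] := by
  have hfac : 0 < δ₀.factorial := Nat.factorial_pos δ₀
  have hNmono : Monotone N := hN.monotone
  have hNtop : ∀ M, ∃ j, M ≤ N j := fun M => ⟨M, hN.le_apply⟩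
  /- 1. the limit shear `h_∞` -/
  obtain ⟨hinf, hhinf0, hH⟩ := exists_powerSeries_limit_of_mul_order hfac h N hN (fun j => (hc j).2.1) hcloseh
  have hHj0 : ∀ j, PowerSeries.constantCoeff (hinf - h j) = 0 := fun j => by rw [map_sub, hhinf0, (hc j).2.1, sub_zero]
  have hjj0 : ∀ j j', PowerSeries.constantCoeff (h j' - h j) = 0 := fun j j' => by rw [map_sub, (hc j).2.1, (hc j').2.1, sub_zero]
  /- 2. the transported re-centrings `g̃_j = θ^*_{h_∞ − h_j} g_j` -/
  let gt : ℕ → MvPowerSeries (Fin 2) k := fun j => subst (PurePowerFlag.shift (hinf - h j)) (g j)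
  have hgt0 : ∀ j, constantCoeff (gt j) = 0 := fun j => constantCoeff_subst_pureShift (hHj0 j) (hc j).1
  -- transport of differences
  have hdiff : ∀ j j', gt j' - gt j =
      subst (PurePowerFlag.shift (hinf - h j')) (g j' - subst (PurePowerFlag.shift (h j' - h j)) (g j)) := by
    intro j j'
    have hθ := HauserPerlega2024.hasSubst_shift (0 : Fin 2) 1 (hinf - h j') (hHj0 j')
    have h1 : subst (PurePowerFlag.shift (hinf - h j')) (subst (PurePowerFlag.shift (h j' - h j)) (g j)) = gt j := by
      have h2 : subst (PurePowerFlag.shift (hinf - h j')) (subst (PurePowerFlag.shift (h j' - h j)) (g j)) =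
          subst (PurePowerFlag.shift ((h j' - h j) + (hinf - h j'))) (g j) :=
        HauserPerlega2024.subst_shift_subst_shift (0 : Fin 2) 1 (by decide) _ _ (hjj0 j j') (hHj0 j') (g j)
      rw [h2, show (h j' - h j) + (hinf - h j') = hinf - h j by ring]
    rw [← h1]
    exact (subst_sub hθ _ _).symm
  -- the member `j'` re-based at member `j`: `flagTuple A g_{j'} h_{j'} = shift (θ_{h_{j'} − h_j} A_j) (g_{j'} − θ^* g_j)`
  have hrebase : ∀ j (g' : MvPowerSeries (Fin 2) k) (h' : PowerSeries k), PowerSeries.constantCoeff h' = 0 →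
      flagTuple d A g' h' = shift d (fun i => subst (PurePowerFlag.shift (h' - h j)) (flagTuple d A (g j) (h j) i))
        (g' - subst (PurePowerFlag.shift (h' - h j)) (g j)) := by
    intro j g' h' hh'
    have hh'' : PowerSeries.constantCoeff (h' - h j) = 0 := by rw [map_sub, hh', (hc j).2.1, sub_zero]
    have h1 := flagTuple_flagTuple A (g j) (g' - subst (PurePowerFlag.shift (h' - h j)) (g j)) (hc j).2.1 hh''
    rw [add_sub_cancel, add_sub_cancel] at h1
    rw [← h1, flagTuple_def d (flagTuple d A (g j) (h j))]
  -- class values of the re-based members and `W`-conditions of the differences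
  have hWdiff : ∀ j j', ∀ w ∈ W, m w ≤ (d.factorial : ℕ∞) *
      (g j' - subst (PurePowerFlag.shift (h j' - h j)) (g j)).weightedOrder w := by
    intro j j' w hw
    set B' : Fin d → MvPowerSeries (Fin 2) k := fun i => subst (PurePowerFlag.shift (h j' - h j)) (flagTuple d A (g j) (h j) i)
    have hB' : wMin w (shift d B' 0) = m w := by rw [shift_zero, (hW w hw _ (hjj0 j j')).1, (hc j).2.2 w hw]
    have hB'' : wMin w (shift d B' (g j' - subst (PurePowerFlag.shift (h j' - h j)) (g j))) = m w := by
      rw [← hrebase j (g j') (h j') (hc j').2.1]; exact (hc j').2.2 w hw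
    have h1 := le_mul_weightedOrder_sub_of_wMin_eq hd w B' 0 _ hB' hB''
    rwa [sub_zero] at h1
  /- 3. the limit re-centring `g_∞` (negligible := strictly below some `m_w/d!` or some `M'`-line) -/
  let Below : ℕ → (Fin 2 →₀ ℕ) → Prop := fun M e =>
    (∃ w ∈ W, ((d.factorial * Finsupp.weight w e : ℕ) : ℕ∞) < m w) ∨
      ∃ M', M' ≤ M ∧ d.factorial * Finsupp.weight ![δ₀.factorial, M'] e < M' * δ₀ + Finsupp.weight ![δ₀.factorial, M'] r₀
  have hmono : ∀ {M M' : ℕ} {e : Fin 2 →₀ ℕ}, M ≤ M' → Below M e → Below M' e := by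
    intro M M' e hMM' hb
    rcases hb with hb | ⟨M'', hM'', hb⟩
    · exact Or.inl hb
    · exact Or.inr ⟨M'', hM''.trans hMM', hb⟩
  have hstep : ∀ j (e : Fin 2 →₀ ℕ), Below (N j) e → coeff e (gt (j + 1) - gt j) = 0 := by
    intro j e he
    have hφ := hHj0 (j + 1)
    rw [hdiff j (j + 1)]
    rcases he with ⟨w, hw, hlt⟩ | ⟨M', hM', hlt⟩
    · have hle : m w ≤ (d.factorial : ℕ∞) *
          (subst (PurePowerFlag.shift (hinf - h (j + 1))) (g (j + 1) - subst (PurePowerFlag.shift (h (j + 1) - h j)) (g j))).weightedOrder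
            w := by
        rw [(hW w hw _ hφ).2]
        exact hWdiff j (j + 1) w hw
      exact coeff_eq_zero_of_weight_lt_of_le hle hlt
    · have hMN : (M' : ℕ∞) ≤ (δ₀.factorial : ℕ∞) * (hinf - h (j + 1)).order :=
        le_trans (by exact_mod_cast hM'.trans (hNmono (Nat.le_succ j))) (hH (j + 1))
      have hle : ((M' * δ₀ + Finsupp.weight ![δ₀.factorial, M'] r₀ : ℕ) : ℕ∞) ≤ (d.factorial : ℕ∞) *
          (subst (PurePowerFlag.shift (hinf - h (j + 1))) (g (j + 1) - subst (PurePowerFlag.shift (h (j + 1) - h j)) (g j))).weightedOrder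
            ![δ₀.factorial, M'] := by
        rw [weightedOrder_subst_shift _ _ hφ hMN]
        exact hlines j (j + 1) (Nat.lt_succ_self j) M' hM'
      exact coeff_eq_zero_of_weight_lt_of_le hle (by exact_mod_cast hlt)
  have h0 : ∃ j, Below (N j) 0 := by
    obtain ⟨w, hw, hmw⟩ := hpos
    exact ⟨0, Or.inl ⟨w, hw, by simpa using hmw⟩⟩
  obtain ⟨ginf, hginf0, -, hginf⟩ := exists_forall_coeff_sub_eq_zero_of_chain'₀ Below hmono gt N hNmono hNtop hstep hgt0 h0
  have hGW : ∀ j, ∀ w ∈ W, m w ≤ (d.factorial : ℕ∞) * (ginf - gt j).weightedOrder w := fun j w hw =>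
    le_mul_weightedOrder_of_coeff fun e he => hginf j e (Or.inl ⟨w, hw, he⟩)
  have hGlines : ∀ j M', M' ≤ N j → ((M' * δ₀ + Finsupp.weight ![δ₀.factorial, M'] r₀ : ℕ) : ℕ∞) ≤
      (d.factorial : ℕ∞) * (ginf - gt j).weightedOrder ![δ₀.factorial, M'] := fun j M' hM' =>
    le_mul_weightedOrder_of_coeff fun e he => hginf j e (Or.inr ⟨M', hM', by exact_mod_cast he⟩)
  /- 4. membership of the limit pair -/
  have hmem : ∀ w ∈ W, wMin w (flagTuple d A ginf hinf) = m w := by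
    have hge : ∀ w ∈ W, m w ≤ wMin w (flagTuple d A ginf hinf) := by
      intro w hw
      rw [hrebase 0 ginf hinf hhinf0]
      set B' : Fin d → MvPowerSeries (Fin 2) k := fun i => subst (PurePowerFlag.shift (hinf - h 0)) (flagTuple d A (g 0) (h 0) i)
      have hB' : wMin w B' = m w := by rw [(hW w hw _ (hHj0 0)).1, (hc 0).2.2 w hw]
      have h1 := wMin_le_wMin_shift w B' (ginf - gt 0) (by rw [hB']; exact hGW 0 w hw)
      rwa [hB'] at h1
    exact fun w hw => le_antisymm (hmax ginf hinf hginf0 hhinf0 hge w hw) (hge w hw)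
  exact ⟨ginf, hinf, hginf0, hhinf0, hmem, fun j => ⟨hH j, hGlines j⟩⟩

end WildMonic

end Summit.ResolutionOfSingularities.ResolutionOfSingularities.Theorems
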